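import Summits.QuantumFields.BalabanUV.Beta.FP.BlockAveragedKernelAxial
import Summits.QuantumFields.BalabanUV.Beta.FP.BlockAveragedKernelScalar

/-!
# Road FP (binder row D1), row H′2-IR ∕ IR-1-ABS — PART 5: EVERY `TwoPower` LEG FAMILY CARRIES THE KERNEL LETTERS (value degree 2,
# difference degree 3), HENCE (i)(ii)(iii) HOLD FOR IT — IN PARTICULAR, UNCONDITIONALLY, FOR THE FREE LEG `latticeGreen∕2` (the level-0 ∕ ghost leg)
# (our bookkeeping over an3-g5's `TwoPowerLegs`; no estimate of Bałaban's propagators)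

HONEST DEPENDENCY (page 1, mandatory): continuum YM on T⁴ ⇐ BetaPertH ∧ nine spine estimates (0/9 proved); BetaPertH ⇐ (D1) ∧ (D4) ∧
CAP+tail; G-an2-4 gates asym, D1 and NE2/3/4.  HONEST FRAMING (cell contract, verbatim): «discharging `BetaPertH` makes Bałaban's UV
stability UNCONDITIONAL — a real constructive-QFT result; it is NOT the continuum limit and NOT the Clay problem.»  THIS MODULE is
bookkeeping: it cites nothing, mints no `def … : Prop`, declares no data `def`, has 0 `sorry`.  INPUT BY NAME: an3-g5's `TwoPowerLegs.TwoPower`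
(a family `g L k : ℤ⁴ → ℝ` with `|g − c₄∕|v|²| ≤ B∕‖v‖∞⁴` off `0` and `|g| ≤ U`), its legs `baseLeg`∕`fwdLeg` (`BubbleTransfer.Leg.abs_f_le`), and
the FREE instance `TwoPowerLegs.free` (`g = latticeGreen∕2`, Lawler–Limic two-powers asymptotics — PROVED in the tree, lit1 v1.1).  It
discharges NOTHING of row H′2-IR, of `hasym`, of D1 or of `BetaPertH`; NOT (CONV-C), NOT D1, NOT the continuum limit, NOT Clay.

ABSOLUTE RULE (cell charter, verbatim): «No internally-minted statement may enter as a cited fact. Every hypothesis is either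
kernel-proved in this package or a verbatim quotation of a PUBLISHED theorem with page reference. The manuscript(s) under audit are NOT
citable for their own disputed steps — they are the thing under adjudication; programme-internal (2001/route/tribunal) claims are never
citable.»

THE ROW's LEVEL-0 CLAUSE (owner d1-p3-g5, «IR-1-ABS»): «the road instantiates `P :=` the entries of the perfect BF propagator kernel
(H2-P-KER-ASM …) and, at level 0, the free `latticeGreen` leg (`TwoPowerLegs.free`)».  THIS FILE does the level-0 half (and every
`TwoPower` family at once); the `P^{BF}` half waits for H2-P-KER-ASM's letters.

CONTENT.
* §1 **`letter_of_twoPower`**: `|T.g L k z| ≤ 4·(T.U + c₄ + T.B)∕(‖z‖∞+1)²`; **`letterDiff_of_twoPower`**: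
  `|T.g L k (z + e_μ) − T.g L k z| ≤ 8·(2·T.U + 2c₄ + T.Bgrad)∕(‖z‖∞+1)³` (PART 1's `abs_le_inv_pow_succ_of_isO` on `baseLeg`∕`fwdLeg` + the sup bound).
* §2 the (i)(ii)(iii) of PARTS 3–4 for any `TwoPower` family, `(L,k)`-FREE constants: `abs_axialAvg_twoPower_le`, `abs_contourAvg_twoPower_le`,
  `abs_axialAvg_twoPower_fwdDiff_le`, `abs_covAvg_twoPower_le_coarse`; `abs_blockAvg_twoPower_le`, `abs_blockAvg_twoPower_fwdDiff_le`,
  `abs_blockAvg₂_twoPower_le_coarse`.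
* §4 MIXED SECOND DIFFERENCES (`μ ≠ ν`, degree 4 = d): `letterDiff₂_of_twoPower` (from `SharpDiff`, an3's `mixedLeg`), `letterDiff₂_free`
  (unconditional via `free_sharp`), **`abs_blockAvg_free_fwdDiff₂_le_marginal`** = IR-4's (D2) at level 0 through PART 4 (ii″), WITH its block-edge logarithm.
* §3 THE FREE LEG, unconditionally: **`abs_blockAvg₂_free_le_coarse`** — the plain double block average of `latticeGreen∕2` (the `Q′G₀Q′ᵀ`
  entry shape of IR-4, up to its `n⁻⁸`) is `≤ (9·104977)²·4(U₀ + c₄ + B₀)∕(n²(1 + ‖u − v‖∞)²)`, `U₀, B₀` the tree's free constants; and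
  **`abs_covAvg_free_le_coarse`** for the contour double average.
Unit `b2b-balaban-gan24-formalise-leaf-04` (gen 39, idle G-an2-4 swarm leaf seat, cross-lane), 2026-08-20; `LEAVES-FP.md` rows IR-1-ABS ∕ IR-1-GEN.
-/

noncomputable section

namespace Summit.QuantumFields.BalabanUV.Beta.FP.BlockAveragedKernelLegs

open Finset
open scoped BigOperators
open Literature.MathematicalPhysics.QuantumFieldTheory.Balaban1983to89.Beta.DyadicShell (Pt supNorm supNorm_eq_zero_iff supNorm_pos)
open Literature.MathematicalPhysics.QuantumFieldTheory.Balaban1983to89.Beta.BubbleTransfer (Leg c4 c4_pos unitVec)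
open Literature.MathematicalPhysics.QuantumFieldTheory.Balaban1983to89.Beta.TwoPowerLegs (TwoPower free free_g)
open Literature.MathematicalPhysics.QuantumFieldTheory.Balaban1983to89.Beta
open Literature.MathematicalPhysics.QuantumFieldTheory.Balaban1983to89.Beta.AxialComposition (axialAvg covAvg)
open Literature.MathematicalPhysics.QuantumFieldTheory.Balaban1983to89.Beta.AffineAveraging (blockSum)
open Literature.Probability.LatticeModels (latticeGreen)
open Summit.QuantumFields.BalabanUV.Beta.FP.BlockAveragedKernel
open Summit.QuantumFields.BalabanUV.Beta.FP.BlockAveragedKernelAxial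
open Summit.QuantumFields.BalabanUV.Beta.FP.BlockAveragedKernelScalar

/-! ## §1 The kernel letters of a `TwoPower` family -/

/-- **VALUE LETTER.**  Every `TwoPower` family satisfies `|g L k z| ≤ 4·(U + c₄ + B)∕(‖z‖∞+1)²` for ALL `z`, constants `(L,k)`-free.
[our bookkeeping] -/
theorem letter_of_twoPower (T : TwoPower) (L k : ℕ) (z : Pt) :
    |T.g L k z| ≤ 4 * (T.U + c4 + T.B) / ((supNorm z : ℝ) + 1) ^ 2 := by
  have hc := c4_pos.le
  have hB := T.nonneg_B
  have hU := T.nonneg_U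
  have h0 : ∀ w, |T.g L k w| ≤ T.U + c4 + T.B := fun w => (T.bdd L k w).trans (by linarith)
  have h1 : ∀ w : Pt, w ≠ 0 → |T.g L k w| ≤ (T.U + c4 + T.B) / (supNorm w : ℝ) ^ 2 := by
    intro w hw
    have h := T.baseLeg.abs_f_le L k hw
    have hA : T.baseLeg.A = c4 := rfl
    have hB' : T.baseLeg.B = T.B := rfl
    simp only [TwoPower.baseLeg_f, TwoPower.baseLeg_a, hA, hB'] at h
    exact h.trans (div_le_div_of_nonneg_right (by linarith) (by positivity))
  have h := abs_le_inv_pow_succ_of_isO (a := 2) h0 h1 z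
  norm_num at h
  exact h

/-- **DIFFERENCE LETTER.**  Every `TwoPower` family satisfies `|g L k (z + e_μ) − g L k z| ≤ 8·(2U + 2c₄ + Bgrad)∕(‖z‖∞+1)³` for ALL `z`
(`Bgrad = 17B + 112c₄ + 2U + 2c₄`, an3's gradient-leg constant). [our bookkeeping] -/
theorem letterDiff_of_twoPower (T : TwoPower) (L k : ℕ) (μ : Fin 4) (z : Pt) :
    |T.g L k (z + Pi.single μ 1) - T.g L k z| ≤ 8 * (2 * T.U + 2 * c4 + T.Bgrad) / ((supNorm z : ℝ) + 1) ^ 3 := by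
  have hc := c4_pos.le
  have hBg := T.Bgrad_nonneg
  have hU := T.nonneg_U
  have h0 : ∀ w, |T.g L k (w + Pi.single μ 1) - T.g L k w| ≤ 2 * T.U + 2 * c4 + T.Bgrad := by
    intro w
    have h1 := T.bdd L k (w + Pi.single μ 1)
    have h2 := T.bdd L k w
    calc |T.g L k (w + Pi.single μ 1) - T.g L k w| ≤ |T.g L k (w + Pi.single μ 1)| + |T.g L k w| := abs_sub _ _
      _ ≤ 2 * T.U + 2 * c4 + T.Bgrad := by linarith
  have h1 : ∀ w : Pt, w ≠ 0 → |T.g L k (w + Pi.single μ 1) - T.g L k w| ≤ (2 * T.U + 2 * c4 + T.Bgrad) / (supNorm w : ℝ) ^ 3 := by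
    intro w hw
    have h := (T.fwdLeg μ).abs_f_le L k hw
    have hA : (T.fwdLeg μ).A = 2 * c4 := rfl
    have hB' : (T.fwdLeg μ).B = T.Bgrad := rfl
    have ha : (T.fwdLeg μ).a = 3 := rfl
    have hf : (T.fwdLeg μ).f L k w = T.g L k (w + Pi.single μ 1) - T.g L k w := rfl
    rw [hf, hA, hB', ha] at h
    exact h.trans (div_le_div_of_nonneg_right (by linarith) (by positivity))
  have h := abs_le_inv_pow_succ_of_isO (a := 3) (f := fun w => T.g L k (w + Pi.single μ 1) - T.g L k w) h0 h1 z
  norm_num at h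
  exact h

/-! ## §2 (i)(ii)(iii) for a `TwoPower` family, `(L,k)`-free constants -/

/-- (i) for a `TwoPower` leg: `|axialAvg n μ′ (v ↦ g(x − v)) u| ≤ 9·531442·(4(U+c₄+B))∕(2n+1+‖x−n•u‖∞)²`. [our bookkeeping] -/
theorem abs_axialAvg_twoPower_le (T : TwoPower) (L k : ℕ) {n : ℕ} (hn : 1 ≤ n) (μ' : Fin 4) (x u : Pt) :
    |axialAvg n μ' (fun v => T.g L k (x - v)) u|
      ≤ 3 ^ 2 * 531442 * (4 * (T.U + c4 + T.B)) / ((((2 * n : ℕ) : ℝ)) + 1 + supNorm (x - n • u)) ^ 2 :=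
  abs_axialAvg_le_profile (by norm_num) (letter_of_twoPower T L k) hn μ' x u

/-- (i) in the owner's currency for a `TwoPower` leg: `n·|axialAvg …| ≤ 9·531442·4(U+c₄+B)∕(n(1+dist∕n)²)`. [our bookkeeping] -/
theorem abs_contourAvg_twoPower_le (T : TwoPower) (L k : ℕ) {n : ℕ} (hn : 1 ≤ n) (μ' : Fin 4) (x u : Pt) :
    (n : ℝ) * |axialAvg n μ' (fun v => T.g L k (x - v)) u|
      ≤ 9 * 531442 * (4 * (T.U + c4 + T.B)) / ((n : ℝ) * (1 + (supNorm (x - n • u) : ℝ) / n) ^ 2) :=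
  abs_contourAvg_le (letter_of_twoPower T L k) hn μ' x u

/-- (ii) for a `TwoPower` leg: `|axialAvg(x + e_i) − axialAvg(x)| ≤ 27·531442·(8(2U+2c₄+Bgrad))∕(2n+1+‖x−n•u‖∞)³`. [our bookkeeping] -/
theorem abs_axialAvg_twoPower_fwdDiff_le (T : TwoPower) (L k : ℕ) (i : Fin 4) {n : ℕ} (hn : 1 ≤ n) (μ' : Fin 4) (x u : Pt) :
    |axialAvg n μ' (fun v => T.g L k (x + Pi.single i 1 - v)) u - axialAvg n μ' (fun v => T.g L k (x - v)) u|
      ≤ 3 ^ (2 + 1) * 531442 * (8 * (2 * T.U + 2 * c4 + T.Bgrad)) / ((((2 * n : ℕ) : ℝ)) + 1 + supNorm (x - n • u)) ^ (2 + 1) :=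
  abs_axialAvg_fwdDiff_le_profile (a := 2) (by norm_num) i (letterDiff_of_twoPower T L k i) hn μ' x u

/-- (iii) for a `TwoPower` leg, coarse distance: `|covAvg n μ′ g u v| ≤ (9·531442)²·4(U+c₄+B)∕(n²(1+‖u−v‖∞)²)`. [our bookkeeping] -/
theorem abs_covAvg_twoPower_le_coarse (T : TwoPower) (L k : ℕ) {n : ℕ} (hn : 1 ≤ n) (μ' : Fin 4) (u v : Pt) :
    |covAvg n μ' (T.g L k) u v| ≤ (3 ^ 2 * 531442) ^ 2 * (4 * (T.U + c4 + T.B)) / ((n : ℝ) ^ 2 * (1 + (supNorm (u - v) : ℝ)) ^ 2) :=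
  abs_covAvg_le_coarse (by norm_num) (letter_of_twoPower T L k) hn μ' u v

/-- (i′) for a `TwoPower` leg through the plain block average: `|n⁻⁴·blockSum n (y ↦ g(x−y)) u| ≤ 9·104977·4(U+c₄+B)∕(n+1+‖x−n•u‖∞)²`.
[our bookkeeping] -/
theorem abs_blockAvg_twoPower_le (T : TwoPower) (L k : ℕ) {n : ℕ} (hn : 1 ≤ n) (x u : Pt) :
    |((n : ℝ) ^ 4)⁻¹ * blockSum n (fun y => T.g L k (x - y)) u|
      ≤ 3 ^ 2 * 104977 * (4 * (T.U + c4 + T.B)) / ((n : ℝ) + 1 + supNorm (x - n • u)) ^ 2 :=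
  abs_blockAvg_le_profile (by norm_num) (letter_of_twoPower T L k) hn x u

/-- (ii′) for a `TwoPower` leg through the plain block average (one power better). [our bookkeeping] -/
theorem abs_blockAvg_twoPower_fwdDiff_le (T : TwoPower) (L k : ℕ) (i : Fin 4) {n : ℕ} (hn : 1 ≤ n) (x u : Pt) :
    |((n : ℝ) ^ 4)⁻¹ * blockSum n (fun y => T.g L k (x + Pi.single i 1 - y)) u
        - ((n : ℝ) ^ 4)⁻¹ * blockSum n (fun y => T.g L k (x - y)) u|
      ≤ 3 ^ (2 + 1) * 104977 * (8 * (2 * T.U + 2 * c4 + T.Bgrad)) / ((n : ℝ) + 1 + supNorm (x - n • u)) ^ (2 + 1) :=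
  abs_blockAvg_fwdDiff_le_profile (a := 2) (by norm_num) i (letterDiff_of_twoPower T L k i) hn x u

/-- (iii′) for a `TwoPower` leg, the plain double block average in coarse distance. [our bookkeeping] -/
theorem abs_blockAvg₂_twoPower_le_coarse (T : TwoPower) (L k : ℕ) {n : ℕ} (hn : 1 ≤ n) (u v : Pt) :
    |((n : ℝ) ^ 4)⁻¹ * blockSum n (fun y => ((n : ℝ) ^ 4)⁻¹ * blockSum n (fun y' => T.g L k (y - y')) v) u|
      ≤ (3 ^ 2 * 104977) ^ 2 * (4 * (T.U + c4 + T.B)) / ((n : ℝ) ^ 2 * (1 + (supNorm (u - v) : ℝ)) ^ 2) :=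
  abs_blockAvg₂_le_coarse (by norm_num) (letter_of_twoPower T L k) hn u v

/-! ## §3 The free leg `latticeGreen∕2`, unconditionally -/

/-- **THE FREE LEG's VALUE LETTER**: `|latticeGreen z∕2| ≤ 4·(U₀ + c₄ + B₀)∕(‖z‖∞+1)²` on all of `ℤ⁴`, `U₀, B₀` the tree's free constants
(`TwoPowerLegs.free.U`, `.B`). [our bookkeeping] -/
theorem letter_free (z : Pt) : |latticeGreen z / 2| ≤ 4 * (free.U + c4 + free.B) / ((supNorm z : ℝ) + 1) ^ 2 := by
  simpa using letter_of_twoPower free 0 0 z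

/-- **THE FREE LEG's DIFFERENCE LETTER**: `|latticeGreen(z+e_μ)∕2 − latticeGreen z∕2| ≤ 8·(2U₀ + 2c₄ + Bgrad₀)∕(‖z‖∞+1)³`. [our bookkeeping] -/
theorem letterDiff_free (μ : Fin 4) (z : Pt) :
    |latticeGreen (z + Pi.single μ 1) / 2 - latticeGreen z / 2| ≤ 8 * (2 * free.U + 2 * c4 + free.Bgrad) / ((supNorm z : ℝ) + 1) ^ 3 := by
  simpa using letterDiff_of_twoPower free 0 0 μ z

/-- **THE GHOST-TYPE DOUBLE BLOCK AVERAGE OF THE FREE LEG** (IR-4's `Q′G₀Q′ᵀ` entry shape up to `n⁻⁸`), unconditionally: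
`|n⁻⁴·blockSum n (y ↦ n⁻⁴·blockSum n (y′ ↦ latticeGreen(y − y′)∕2) v) u| ≤ (9·104977)²·4(U₀ + c₄ + B₀)∕(n²(1 + ‖u − v‖∞)²)`. [our bookkeeping] -/
theorem abs_blockAvg₂_free_le_coarse {n : ℕ} (hn : 1 ≤ n) (u v : Pt) :
    |((n : ℝ) ^ 4)⁻¹ * blockSum n (fun y => ((n : ℝ) ^ 4)⁻¹ * blockSum n (fun y' => latticeGreen (y - y') / 2) v) u|
      ≤ (3 ^ 2 * 104977) ^ 2 * (4 * (free.U + c4 + free.B)) / ((n : ℝ) ^ 2 * (1 + (supNorm (u - v) : ℝ)) ^ 2) := by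
  simpa using abs_blockAvg₂_twoPower_le_coarse free 0 0 hn u v

/-- **THE CONTOUR DOUBLE AVERAGE OF THE FREE LEG** in coarse distance, unconditionally. [our bookkeeping] -/
theorem abs_covAvg_free_le_coarse {n : ℕ} (hn : 1 ≤ n) (μ' : Fin 4) (u v : Pt) :
    |covAvg n μ' (fun z => latticeGreen z / 2) u v|
      ≤ (3 ^ 2 * 531442) ^ 2 * (4 * (free.U + c4 + free.B)) / ((n : ℝ) ^ 2 * (1 + (supNorm (u - v) : ℝ)) ^ 2) := by
  have h := abs_covAvg_twoPower_le_coarse free 0 0 hn μ' u v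
  have e : free.g 0 0 = fun z => latticeGreen z / 2 := funext fun z => free_g 0 0 z
  rw [e] at h
  exact h

/-! ## §4 Mixed second differences (`μ ≠ ν`): the marginal-degree letter from SHARP differences, and the free leg's (D2) with its logarithm -/

/-- **MIXED SECOND-DIFFERENCE LETTER** (`μ ≠ ν`, degree `4 = d`): a `TwoPower` family with SHARP unit differences (`SharpDiff T B₃`) satisfies
`|g(z+e_μ+e_ν) − g(z+e_μ) − g(z+e_ν) + g z| ≤ 16·(4U + 10c₄ + Bmix B₃)∕(‖z‖∞+1)⁴` on all of `ℤ⁴` (an3's `mixedLeg` + the sup bound). [our bookkeeping] -/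
theorem letterDiff₂_of_twoPower (T : TwoPower) {B₃ : ℝ} (hB : 0 ≤ B₃) (hS : TwoPowerLegs.SharpDiff T B₃) (L k : ℕ) {μ ν : Fin 4} (hμν : μ ≠ ν)
    (z : Pt) :
    |T.g L k (z + Pi.single μ 1 + Pi.single ν 1) - T.g L k (z + Pi.single μ 1) - T.g L k (z + Pi.single ν 1) + T.g L k z|
      ≤ 16 * (4 * T.U + 10 * c4 + T.Bmix B₃) / ((supNorm z : ℝ) + 1) ^ 4 := by
  have hc := c4_pos.le
  have hU := T.nonneg_U
  have hBm : 0 ≤ T.Bmix B₃ := (T.mixedLeg hμν hB hS).nonneg_B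
  -- the mixed leg's function, written in our order of the two unit shifts
  have hf : ∀ w, (T.mixedLeg hμν hB hS).f L k w
      = T.g L k (w + Pi.single μ 1 + Pi.single ν 1) - T.g L k (w + Pi.single μ 1) - T.g L k (w + Pi.single ν 1) + T.g L k w := by
    intro w
    show T.g L k (w + unitVec ν + unitVec μ) - T.g L k (w + unitVec ν) - T.g L k (w + unitVec μ) + T.g L k w = _
    simp only [unitVec]
    rw [add_right_comm w (Pi.single ν 1) (Pi.single μ 1)]
    ring
  have h0 : ∀ w, |T.g L k (w + Pi.single μ 1 + Pi.single ν 1) - T.g L k (w + Pi.single μ 1) - T.g L k (w + Pi.single ν 1) + T.g L k w|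
      ≤ 4 * T.U + 10 * c4 + T.Bmix B₃ := by
    intro w
    have h1 := T.bdd L k (w + Pi.single μ 1 + Pi.single ν 1)
    have h2 := T.bdd L k (w + Pi.single μ 1)
    have h3 := T.bdd L k (w + Pi.single ν 1)
    have h4 := T.bdd L k w
    have e : |T.g L k (w + Pi.single μ 1 + Pi.single ν 1) - T.g L k (w + Pi.single μ 1) - T.g L k (w + Pi.single ν 1) + T.g L k w|
        ≤ |T.g L k (w + Pi.single μ 1 + Pi.single ν 1)| + |T.g L k (w + Pi.single μ 1)| + |T.g L k (w + Pi.single ν 1)|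
          + |T.g L k w| := by
      refine (abs_add_le _ _).trans (add_le_add ((abs_sub _ _).trans (add_le_add (abs_sub _ _) le_rfl)) le_rfl)
    linarith
  have h1 : ∀ w : Pt, w ≠ 0 →
      |T.g L k (w + Pi.single μ 1 + Pi.single ν 1) - T.g L k (w + Pi.single μ 1) - T.g L k (w + Pi.single ν 1) + T.g L k w|
        ≤ (4 * T.U + 10 * c4 + T.Bmix B₃) / (supNorm w : ℝ) ^ 4 := by
    intro w hw
    have h := (T.mixedLeg hμν hB hS).abs_f_le L k hw
    have hA : (T.mixedLeg hμν hB hS).A = 10 * c4 := rfl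
    have hB' : (T.mixedLeg hμν hB hS).B = T.Bmix B₃ := rfl
    rw [hf, hA, hB', TwoPower.mixedLeg_a] at h
    exact h.trans (div_le_div_of_nonneg_right (by linarith) (by positivity))
  have h := abs_le_inv_pow_succ_of_isO (a := 4)
    (f := fun w => T.g L k (w + Pi.single μ 1 + Pi.single ν 1) - T.g L k (w + Pi.single μ 1) - T.g L k (w + Pi.single ν 1) + T.g L k w)
    h0 h1 z
  norm_num at h
  exact h

/-- **THE FREE LEG's MIXED SECOND-DIFFERENCE LETTER** (`μ ≠ ν`), unconditionally (`TwoPowerLegs.free_sharp`): with `B₃ :=` the tree's sharp constant,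
`|G₀(z+e_μ+e_ν) − G₀(z+e_μ) − G₀(z+e_ν) + G₀ z| ≤ 16·(4U₀ + 10c₄ + Bmix B₃)∕(‖z‖∞+1)⁴`, `G₀ = latticeGreen∕2`. [our bookkeeping] -/
theorem letterDiff₂_free {μ ν : Fin 4} (hμν : μ ≠ ν) (z : Pt) :
    |latticeGreen (z + Pi.single μ 1 + Pi.single ν 1) / 2 - latticeGreen (z + Pi.single μ 1) / 2 - latticeGreen (z + Pi.single ν 1) / 2
        + latticeGreen z / 2|
      ≤ 16 * (4 * free.U + 10 * c4 + free.Bmix (Classical.choose TwoPowerLegs.free_sharp)) / ((supNorm z : ℝ) + 1) ^ 4 := by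
  simpa using letterDiff₂_of_twoPower free (Classical.choose_spec TwoPowerLegs.free_sharp).1
    (Classical.choose_spec TwoPowerLegs.free_sharp).2 0 0 hμν z

/-- **(D2) FOR THE FREE LEG THROUGH THE PLAIN BLOCK AVERAGE, `μ ≠ ν` — WITH ITS LOGARITHM** (PART 4 (ii″) at the free letter): the mixed second
difference in `x` of `n⁻⁴·blockSum n (y ↦ G₀(x − y)) u` is `≤ 81·(16·(97 + 64·log(3n)) + 1)·(16(4U₀ + 10c₄ + Bmix B₃)) ∕ (n+1+‖x−n•u‖∞)⁴` — the named
(D2) input of IR-4 at level 0; log-free sup-norm versions are not offered (block-edge logarithm). [our bookkeeping] -/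
theorem abs_blockAvg_free_fwdDiff₂_le_marginal {μ ν : Fin 4} (hμν : μ ≠ ν) {n : ℕ} (hn : 1 ≤ n) (x u : Pt) :
    |((n : ℝ) ^ 4)⁻¹ * blockSum n (fun y => latticeGreen (x + Pi.single μ 1 + Pi.single ν 1 - y) / 2) u
        - ((n : ℝ) ^ 4)⁻¹ * blockSum n (fun y => latticeGreen (x + Pi.single μ 1 - y) / 2) u
        - ((n : ℝ) ^ 4)⁻¹ * blockSum n (fun y => latticeGreen (x + Pi.single ν 1 - y) / 2) u
        + ((n : ℝ) ^ 4)⁻¹ * blockSum n (fun y => latticeGreen (x - y) / 2) u|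
      ≤ 81 * (16 * (97 + 64 * Real.log ((3 * n : ℕ) : ℝ)) + 1)
          * (16 * (4 * free.U + 10 * c4 + free.Bmix (Classical.choose TwoPowerLegs.free_sharp)))
          / ((n : ℝ) + 1 + supNorm (x - n • u)) ^ 4 :=
  abs_blockAvg_fwdDiff₂_le_profile_marginal (P := fun z => latticeGreen z / 2) μ ν (fun z => letterDiff₂_free hμν z) hn x u

end Summit.QuantumFields.BalabanUV.Beta.FP.BlockAveragedKernelLegs

end
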